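import Summits.CriticalPhenomena.PercolationContinuityZ3.Theorems.PercNearOneGluingNoHeavyLowerTailAntitheticHarris
import HarnessLib

/-!
# `NoHeavyLowerTail` (stmt-CriticalPhenomena-4575) — antithetic cluster pairs: the bivariate ('2-increasing') Harris layer,
# i.e. CONJECTURE Π of the antithetic programme in the sink-free case `R = ∅` (prim-hp-2 gen 49, MEMO-gen49 §4c, §10)

Support file (`--supports stmt-CriticalPhenomena-4575`, hull-port prover `prim-hp-2`, gen 49).  No definitions, no named facts,
no sorries; standard axioms.

THEOREM-FrozenPieces §3 (gen 46) records the dual form of CONJECTURE Π: for every kernel `Y` of two cluster arguments that is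
2-INCREASING (`Y a b + Y c d ≤ Y a d + Y c b` whenever `c ≤ a`, `b ≤ d`; e.g. `Y a b = F a * G b` with `F, G` increasing) the
antithetic pair `(C, C′)` of red/blue clusters should satisfy `Σ_ω Y(C,C′) ≤ Σ_ω Y(C,C)` ("the diagonal coupling dominates the
antithetic coupling in the supermodular order").  This file proves the sink-free case for EVERY monotone poset-valued statistic of
a uniform configuration, by the one-coordinate telescoping of MEMO-gen49 §10 (reveal a coordinate `a`; the 2-increasing inequality
at the four points `X(T+a), X(T), X(Tᶜ+a), X(Tᶜ)` trades the antithetic cross terms for the two half-cube antithetic forms):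

* `Antithetic.twoIncreasing_powerset_sum_le` — for `X : Finset ι → α` monotone and `Y` 2-increasing,
  `Σ_{T ⊆ s} Y (X T) (X (s ∖ T)) ≤ Σ_{T ⊆ s} Y (X T) (X T)` (induction on `s`);
* `Antithetic.twoIncreasing_antithetic_le` — the same over all `ω : Set ι` with the complement `ωᶜ`;
* `Antithetic.twoIncreasing_clusters_le`, `Antithetic.twoIncreasing_clusters_nonneg` — the cluster forms
  `Σ_ω Y(C_s(ω∩E), C_s(ωᶜ∩E)) ≤ Σ_ω Y(C_s(ω∩E), C_s(ω∩E))` and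
  `0 ≤ Σ_ω [Y(C,C) + Y(C′,C′) − Y(C,C′) − Y(C′,C)]`, which for `Y a b = F a * G b` is `Antithetic.antithetic_harris`.
[cite: VandenbergHaggstromKahn2005, §1 p. 6 ("Harris' inequality")]
-/

noncomputable section

namespace Summit.CriticalPhenomena.PercolationContinuityZ3.Theorems

open Literature.Probability.Percolation
open scoped Classical

namespace Antithetic

section Powerset

variable {ι : Type*} {α : Type*} [Preorder α]

/-- **Bivariate antithetic Harris on a powerset.**  If `X : Finset ι → α` is monotone and `Y` is 2-increasing
(`Y a b + Y c d ≤ Y a d + Y c b` for `c ≤ a`, `b ≤ d`), then `Σ_{T ⊆ s} Y (X T) (X (s ∖ T)) ≤ Σ_{T ⊆ s} Y (X T) (X T)`.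
Proof: induction on `s`; inserting `a`, the four values `X (insert a T) ≥ X T`, `X (insert a (s ∖ T)) ≥ X (s ∖ T)` and the
2-increasing inequality reduce the claim to the induction hypothesis for `X` and for `X ∘ insert a`. [folklore] -/
theorem twoIncreasing_powerset_sum_le (Y : α → α → ℝ)
    (hY : ∀ a b c d : α, c ≤ a → b ≤ d → Y a b + Y c d ≤ Y a d + Y c b) (s : Finset ι) :
    ∀ X : Finset ι → α, Monotone X →
      ∑ T ∈ s.powerset, Y (X T) (X (s \ T)) ≤ ∑ T ∈ s.powerset, Y (X T) (X T) := by
  induction s using Finset.induction_on with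
  | empty =>
    intro X hX
    simp
  | @insert a s ha ih =>
    intro X hX
    rw [Finset.sum_powerset_insert ha, Finset.sum_powerset_insert ha]
    -- rewrite the complements inside `insert a s`
    have h1 : ∑ T ∈ s.powerset, Y (X T) (X (insert a s \ T)) =
        ∑ T ∈ s.powerset, Y (X T) (X (insert a (s \ T))) := by
      refine Finset.sum_congr rfl fun T hT => ?_
      have haT : a ∉ T := fun h => ha (Finset.mem_powerset.1 hT h)
      rw [Finset.insert_sdiff_of_notMem s haT]
    have h2 : ∑ T ∈ s.powerset, Y (X (insert a T)) (X (insert a s \ insert a T)) =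
        ∑ T ∈ s.powerset, Y (X (insert a T)) (X (s \ T)) := by
      refine Finset.sum_congr rfl fun T hT => ?_
      rw [Finset.insert_sdiff_insert, Finset.sdiff_insert_of_notMem ha]
    rw [h1, h2]
    -- the shifted statistic `X₁ T = X (insert a T)` is monotone
    have hX1 : Monotone fun T : Finset ι => X (insert a T) :=
      fun T T' hTT' => hX (Finset.insert_subset_insert a hTT')
    -- pointwise 2-increasing step
    have hstep : ∀ T ∈ s.powerset,
        Y (X T) (X (insert a (s \ T))) + Y (X (insert a T)) (X (s \ T)) ≤
          Y (X (insert a T)) (X (insert a (s \ T))) + Y (X T) (X (s \ T)) := by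
      intro T _
      have hca : X T ≤ X (insert a T) := hX (Finset.subset_insert a T)
      have hbd : X (s \ T) ≤ X (insert a (s \ T)) := hX (Finset.subset_insert a _)
      have := hY (X (insert a T)) (X (s \ T)) (X T) (X (insert a (s \ T))) hca hbd
      linarith
    have hsum := Finset.sum_le_sum hstep
    rw [Finset.sum_add_distrib, Finset.sum_add_distrib] at hsum
    -- induction hypothesis for `X₁` and `X`
    have ih1 := ih (fun T => X (insert a T)) hX1
    have ih0 := ih X hX
    linarith

end Powerset

section Cube

variable {ι : Type*} [Fintype ι] {α : Type*} [Preorder α]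

/-- **Bivariate antithetic Harris on the cube** `Set ι`: for `X : Set ι → α` monotone and `Y` 2-increasing,
`Σ_ω Y (X ω) (X ωᶜ) ≤ Σ_ω Y (X ω) (X ω)`.  (With `Y a b = F a * G b` this is `E[F G] ≥ E[F(ω) G(ωᶜ)]`, Harris
twice; the point is that only the joint 2-increasing property is used.) [folklore] -/
theorem twoIncreasing_antithetic_le (Y : α → α → ℝ)
    (hY : ∀ a b c d : α, c ≤ a → b ≤ d → Y a b + Y c d ≤ Y a d + Y c b)
    (X : Set ι → α) (hX : Monotone X) :
    ∑ ω : Set ι, Y (X ω) (X ωᶜ) ≤ ∑ ω : Set ι, Y (X ω) (X ω) := by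
  classical
  -- transfer to `Finset ι` via `T ↦ ↑T`
  have hXc : Monotone fun T : Finset ι => X (↑T : Set ι) :=
    fun T T' h => hX (Finset.coe_subset.2 h)
  have key := twoIncreasing_powerset_sum_le Y hY (Finset.univ : Finset ι) (fun T => X (↑T : Set ι)) hXc
  rw [Finset.powerset_univ] at key
  have e1 : ∑ ω : Set ι, Y (X ω) (X ωᶜ) =
      ∑ T : Finset ι, Y (X (↑T : Set ι)) (X (↑(Finset.univ \ T) : Set ι)) := by
    refine (Fintype.sum_equiv Fintype.finsetEquivSet
      (fun T : Finset ι => Y (X (↑T : Set ι)) (X (↑(Finset.univ \ T) : Set ι)))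
      (fun ω : Set ι => Y (X ω) (X ωᶜ)) fun T => ?_).symm
    simp [Fintype.finsetEquivSet, Finset.coe_sdiff, Set.compl_eq_univ_sdiff]
  have e2 : ∑ ω : Set ι, Y (X ω) (X ω) = ∑ T : Finset ι, Y (X (↑T : Set ι)) (X (↑T : Set ι)) := by
    refine (Fintype.sum_equiv Fintype.finsetEquivSet
      (fun T : Finset ι => Y (X (↑T : Set ι)) (X (↑T : Set ι))) (fun ω : Set ι => Y (X ω) (X ω)) fun T => ?_).symm
    simp [Fintype.finsetEquivSet]
  rw [e1, e2]
  exact key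

end Cube

section Clusters

variable {V : Type*} [Fintype V]

/-- **CONJECTURE Π in the sink-free case (`R = ∅`), one-sided form.**  For every kernel `Y` of two edge-set arguments
that is 2-increasing for `⊆`, the antithetic (red, blue) cluster pair of `s` satisfies
`Σ_ω Y(C_s(ω∩E), C_s(ωᶜ∩E)) ≤ Σ_ω Y(C_s(ω∩E), C_s(ω∩E))`. [cite: VandenbergHaggstromKahn2005, §1 p. 6 ("Harris' inequality")] -/
theorem twoIncreasing_clusters_le (E : Set (Sym2 V)) (s : V) {Y : Set (Sym2 V) → Set (Sym2 V) → ℝ}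
    (hY : ∀ a b c d : Set (Sym2 V), c ≤ a → b ≤ d → Y a b + Y c d ≤ Y a d + Y c b) :
    ∑ ω : Set (Sym2 V), Y (openEdgeCluster (ω ∩ E) s) (openEdgeCluster (ωᶜ ∩ E) s) ≤
      ∑ ω : Set (Sym2 V), Y (openEdgeCluster (ω ∩ E) s) (openEdgeCluster (ω ∩ E) s) :=
  twoIncreasing_antithetic_le Y hY (fun ω => openEdgeCluster (ω ∩ E) s) (red_mono E s)

/-- **CONJECTURE Π in the sink-free case, symmetric form**: `0 ≤ Σ_ω [Y(C,C) + Y(C′,C′) − Y(C,C′) − Y(C′,C)]` for every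
2-increasing kernel `Y` (`C, C′` the red and blue clusters of `s`).  For `Y a b = F a * G b` with `F, G` increasing this is
`Antithetic.antithetic_harris`. [cite: VandenbergHaggstromKahn2005, §1 p. 6 ("Harris' inequality")] -/
theorem twoIncreasing_clusters_nonneg (E : Set (Sym2 V)) (s : V) {Y : Set (Sym2 V) → Set (Sym2 V) → ℝ}
    (hY : ∀ a b c d : Set (Sym2 V), c ≤ a → b ≤ d → Y a b + Y c d ≤ Y a d + Y c b) :
    0 ≤ ∑ ω : Set (Sym2 V), (Y (openEdgeCluster (ω ∩ E) s) (openEdgeCluster (ω ∩ E) s)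
      + Y (openEdgeCluster (ωᶜ ∩ E) s) (openEdgeCluster (ωᶜ ∩ E) s)
      - Y (openEdgeCluster (ω ∩ E) s) (openEdgeCluster (ωᶜ ∩ E) s)
      - Y (openEdgeCluster (ωᶜ ∩ E) s) (openEdgeCluster (ω ∩ E) s)) := by
  -- the transposed kernel is 2-increasing as well
  have hYt : ∀ a b c d : Set (Sym2 V), c ≤ a → b ≤ d →
      Y b a + Y d c ≤ Y d a + Y b c := by
    intro a b c d hca hbd
    have := hY d c b a hbd hca
    linarith
  have h1 := twoIncreasing_clusters_le E s hY
  have h2 := twoIncreasing_antithetic_le (fun a b => Y b a) hYt (fun ω => openEdgeCluster (ω ∩ E) s) (red_mono E s)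
  -- `Σ_ω Y(C′,C′) = Σ_ω Y(C,C)` and `Σ_ω Y(C′,C) = Σ_ω Y(C(ωᶜ), C(ω))` by the complement involution
  have h3 : ∑ ω : Set (Sym2 V), Y (openEdgeCluster (ωᶜ ∩ E) s) (openEdgeCluster (ωᶜ ∩ E) s) =
      ∑ ω : Set (Sym2 V), Y (openEdgeCluster (ω ∩ E) s) (openEdgeCluster (ω ∩ E) s) :=
    sum_red_eq_sum_blue E s (fun a => Y a a)
  rw [Finset.sum_sub_distrib, Finset.sum_sub_distrib, Finset.sum_add_distrib, h3]
  linarith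

end Clusters

end Antithetic

end Summit.CriticalPhenomena.PercolationContinuityZ3.Theorems
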